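import Mathlib
import Summits.NavierStokesRegularity.NavierStokesRegularity.Theorems.TaoLadderRungTwoBreakOneShiftWindowPairCloseD
import Summits.NavierStokesRegularity.NavierStokesRegularity.Theorems.TaoLadderRungTwoBreakOneShiftWindowRoughStepD
import HarnessLib

/-!
# The one-shift window system, XXXIV: THE PAIR-SLOPE STEP FROM DYADIC DATA — one Boolean `PairStepD.check` that,
# when `true`, yields for ANY two runs `S_u`, `S_v` of the SAME rough realisation from `a, b` in the start box:
# `S_u(h) − S_v(h) = U · (a − b)` with `U ∈ [VV.lo − Ẑ₂, VV.hi + Ẑ₂]` (part XVI `exists_stepPairSlope` fed by parts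
# XXVIII–XXXIII and XV `abs_pairGrowth_le`) — the per-step slope enclosure `A_s` of the replay (cell
# harvest/h2-tao-ladder, seat p2; rung1/KERNEL-CHEAP-REPLAY-SPEC.md §2 (e), §6 (iii)/(iv), §7 «per-step pair slope»;
# support for K1(1) = `NoSurvivingDSSOne`, stmt-NavierStokesRegularity-20205)

MODEL lattice ODEs only (Tao 2016 §4 normal form on Tao's shift set `S`); nothing here is a statement about
the Navier–Stokes equations; no item is closed; no instance is evaluated here. Generic in `ι` (numbered by
`e : ι ≃ Fin n`) and `κ`; COMPUTATIONAL (referee P162) once an instance's `check` is evaluated by `native_decide`.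

THE DATA (`PairStepD`): a rough step (part XXXI: term data, `W`, `S`, `h`, `VV`, `Ẑ₁`, `η`, `ζ`) plus the growth
matrix `Zg` (`|S_u − S_v − (a − b)| ≤ Zg |a − b|`, so `Wb = I + Zg`), the pair-deviation matrix `Zh2` (`Ẑ₂`) and a
rough contraction direction `zetaR` (all `n × n` resp. `n` dyadics, column-major). THE COMPUTATION: the rough-step
test; over the hull `Hs`: the sparse rough / centre Jacobian-magnitude rows (part XXXII, diagonal filtered out for
`R`), the rough diagonal bounds and weights `E_r`; the growth fixed point `((R_r Zg)_{il} + Ab_{il}) E_r,i ≤ Zg_{il}`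
and direction; the proximity vector `prox = Wb·diam(W) + Ẑ₁ + |VV|·diam(W)`; the closeness rows `adRow prox` (part
XXXII); the pair fixed point `((R_c Ẑ₂)_{il} + (AΔ Wb)_{il}) E_i ≤ Ẑ₂,il` and direction — every matrix product sparse
row × dense column. THE THEOREM `PairStepD.sound`.
-/

-- the sub-problem namespace repeats the summit name by design (D-0017)
set_option linter.dupNamespace false

namespace Summit.NavierStokesRegularity.NavierStokesRegularity.Theorems

namespace DSSOneShift

open Set Finset Metric Filter Topology TopologicalSpace
open Literature.Analysis.ODE
open Summit.NavierStokesRegularity.NavierStokesRegularity.Theorems.TaylorModelCert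
open Summit.NavierStokesRegularity.NavierStokesRegularity.Theorems.TaylorModelReadout
open Summit.NavierStokesRegularity.NavierStokesRegularity.Theorems.CertificateGlueOn

/-! ### The dyadic data of a pair step and its Boolean test -/

/-- **The dyadic data of one pair-slope step.** [cite: KapelaZgliczynski2009, §4 Lemma 4.1 / Thm. 9; cell vocabulary, harvest/h2-tao-ladder rung1/KERNEL-CHEAP-REPLAY-SPEC.md §6 (iii)] -/
structure PairStepD extends RoughStepD where
  /-- growth matrix `Zg` (column-major, `(i,l)` at `l·n + i`) -/
  Zg : Array Dyad
  /-- pair-deviation matrix `Ẑ₂` -/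
  Zh2 : Array Dyad
  /-- rough contraction direction -/
  zetaR : Array Dyad

namespace PairStepD

variable (d : PairStepD)

/-- Matrix reader (column-major, junk `0`). [folklore] -/
def mget (A : Array Dyad) (i l : ℕ) : Dyad := RoughStepD.dget A (l * d.n + i)

/-- Row `c` of the term data. [folklore] -/
def row (c : ℕ) : List RTermD := rrow d.RD c

/-- The hull of the rough step. [folklore] -/
def Hs : Array IntervalD := d.toRoughStepD.Hs

/-- Sparse ROUGH Jacobian-magnitude row (all columns: `Ab`). [folklore] -/
def AbRow (c : ℕ) : List (ℕ × Dyad) := magRow d.prec (RFac.rval d.Hs) (d.row c)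

/-- Sparse ROUGH off-diagonal row (`R_r`). [folklore] -/
def RrRow (c : ℕ) : List (ℕ × Dyad) := (d.AbRow c).filter fun p => p.1 ≠ c

/-- Sparse CENTRE off-diagonal row (`R_c`). [folklore] -/
def RcRow (c : ℕ) : List (ℕ × Dyad) := (magRow d.prec (RFac.cval d.Hs) (d.row c)).filter fun p => p.1 ≠ c

/-- Rough diagonal bound. [folklore] -/
def dgR (c : ℕ) : Dyad := (jacRowR d.prec d.Hs c (d.row c)).hi

/-- `max (dg_r h) 0`. [folklore] -/
def xplusR (c : ℕ) : Dyad := Dyad.max ((d.dgR c).mul d.hD) (Dyad.ofInt 0)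

/-- Rough weight `E_r = h (1 + max (dg_r h) 0)`. [folklore] -/
def ER (c : ℕ) : Dyad := d.hD.mul ((Dyad.ofInt 1).add (d.xplusR c))

/-- Sparse row · dense column, rounded. [folklore] -/
def rowDot (r : List (ℕ × Dyad)) (v : ℕ → Dyad) : IntervalD :=
  r.foldr (fun p acc => IntervalD.addR d.prec (IntervalD.mulR d.prec (IntervalD.ofDyad p.2) (IntervalD.ofDyad (v p.1))) acc)
    (IntervalD.ofInt 0)

/-- Width of the start box. [folklore] -/
def diam (c : ℕ) : Dyad := (IntervalD.aget d.W c).hi.sub (IntervalD.aget d.W c).lo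

/-- `Wb = I + Zg` entry. [folklore] -/
def Wb (i l : ℕ) : Dyad := (if i = l then Dyad.ofInt 1 else Dyad.ofInt 0).add (d.mget d.Zg i l)

/-- `|VV|` entry. [folklore] -/
def magVV (i l : ℕ) : Dyad := IntervalD.mag (d.toRoughStepD.centre.vv i l)

/-- The proximity bound `prox_c = Σ_l Wb_cl diam_l + Ẑ₁_c + Σ_l |VV|_cl diam_l` (upper endpoint). [folklore] -/
def proxD (c : ℕ) : Dyad :=
  (IntervalD.addR d.prec
    (IntervalD.addR d.prec
      (IntervalD.rangeSumR d.prec (fun l => IntervalD.mulR d.prec (IntervalD.ofDyad (d.Wb c l)) (IntervalD.ofDyad (d.diam l))) d.n)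
      (IntervalD.ofDyad (RoughStepD.dget d.Zh c)))
    (IntervalD.rangeSumR d.prec (fun l => IntervalD.mulR d.prec (IntervalD.ofDyad (d.magVV c l)) (IntervalD.ofDyad (d.diam l))) d.n)).hi

/-- Sparse closeness row `AΔ`. [folklore] -/
def AdRow (c : ℕ) : List (ℕ × Dyad) := adRow d.proxD (d.row c)

/-- The growth test at `(i, l)`: `((R_r Zg)_{il} + Ab_{il}) E_r,i ≤ Zg_{il}`. [folklore] -/
def growthOK (i l : ℕ) : Bool :=
  IntervalD.hiLe
    (IntervalD.mulR d.prec
      (IntervalD.addR d.prec (d.rowDot (d.RrRow i) fun c => d.mget d.Zg c l)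
        (d.rowDot (d.AbRow i) fun c => if c = l then Dyad.ofInt 1 else Dyad.ofInt 0))
      (IntervalD.ofDyad (d.ER i)))
    (d.mget d.Zg i l)

/-- The pair test at `(i, l)`: `((R_c Ẑ₂)_{il} + (AΔ Wb)_{il}) E_i ≤ Ẑ₂,il`. [folklore] -/
def pairOK (i l : ℕ) : Bool :=
  IntervalD.hiLe
    (IntervalD.mulR d.prec
      (IntervalD.addR d.prec (d.rowDot (d.RcRow i) fun c => d.mget d.Zh2 c l) (d.rowDot (d.AdRow i) fun c => d.Wb c l))
      (IntervalD.ofDyad (d.toRoughStepD.ED i)))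
    (d.mget d.Zh2 i l)

/-- The pair-step test proper. [cite: KapelaZgliczynski2009, §4 Lemma 4.1 / Thm. 9] -/
def checkPair : Bool :=
  (List.range d.n).all fun i =>
    Dyad.blt (Dyad.ofInt 0) (RoughStepD.dget d.zetaR i) &&
    Dyad.ble (d.xplusR i) (Dyad.ofInt 1) &&
    Dyad.ble (Dyad.ofInt 0) (d.proxD i) &&
    IntervalD.hiLe (IntervalD.mulR d.prec (d.rowDot (d.RrRow i) (RoughStepD.dget d.zetaR)) (IntervalD.ofDyad (d.ER i)))
      (RoughStepD.dget d.zetaR i) &&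
    IntervalD.hiLe (IntervalD.mulR d.prec (d.rowDot (d.RcRow i) (RoughStepD.dget d.zeta)) (IntervalD.ofDyad (d.toRoughStepD.ED i)))
      (RoughStepD.dget d.zeta i) &&
    (List.range d.n).all fun l =>
      Dyad.ble (Dyad.ofInt 0) (d.mget d.Zg i l) && Dyad.ble (Dyad.ofInt 0) (d.mget d.Zh2 i l) && d.growthOK i l && d.pairOK i l

/-- **THE PAIR-STEP TEST.** [cite: KapelaZgliczynski2009, §4; WalawskaWilczak2016, §2.1] -/
def check : Bool := d.toRoughStepD.check && d.checkPair

/-! ### Unpacking -/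

/-- What `checkPair = true` says. [folklore] -/
theorem of_checkPair (h : d.checkPair = true) : ∀ i < d.n,
    0 < (RoughStepD.dget d.zetaR i).toReal ∧ (d.xplusR i).toReal ≤ 1 ∧ 0 ≤ (d.proxD i).toReal ∧
    IntervalD.hiLe (IntervalD.mulR d.prec (d.rowDot (d.RrRow i) (RoughStepD.dget d.zetaR)) (IntervalD.ofDyad (d.ER i)))
      (RoughStepD.dget d.zetaR i) = true ∧
    IntervalD.hiLe (IntervalD.mulR d.prec (d.rowDot (d.RcRow i) (RoughStepD.dget d.zeta)) (IntervalD.ofDyad (d.toRoughStepD.ED i)))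
      (RoughStepD.dget d.zeta i) = true ∧
    ∀ l < d.n, 0 ≤ (d.mget d.Zg i l).toReal ∧ 0 ≤ (d.mget d.Zh2 i l).toReal ∧ d.growthOK i l = true ∧ d.pairOK i l = true := by
  unfold checkPair at h
  simp only [Bool.and_eq_true, List.all_eq_true, List.mem_range] at h
  intro i hi
  obtain ⟨⟨⟨⟨⟨h1, h2⟩, h3⟩, h4⟩, h5⟩, h6⟩ := h i hi
  refine ⟨by simpa using (Dyad.blt_iff _ _).1 h1, by simpa using (Dyad.ble_iff _ _).1 h2,
    by simpa using (Dyad.ble_iff _ _).1 h3, h4, h5, fun l hl => ?_⟩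
  obtain ⟨⟨⟨h7, h8⟩, h9⟩, h10⟩ := h6 l hl
  exact ⟨by simpa using (Dyad.ble_iff _ _).1 h7, by simpa using (Dyad.ble_iff _ _).1 h8, h9, h10⟩

/-- `rowDot` encloses the sparse product `Σ_{(c,r)} r · v c`. [folklore] -/
theorem mem_rowDot (v : ℕ → Dyad) : ∀ r : List (ℕ × Dyad),
    IntervalD.mem ((r.map fun p => p.2.toReal * (v p.1).toReal).sum) (d.rowDot r v)
  | [] => by simpa [rowDot] using IntervalD.mem_ofInt 0
  | p :: r => by
    simp only [rowDot, List.foldr_cons, List.map_cons, List.sum_cons]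
    exact IntervalD.mem_addR d.prec (IntervalD.mem_mulR d.prec (IntervalD.mem_ofDyad _) (IntervalD.mem_ofDyad _))
      (mem_rowDot v r)

end PairStepD

end DSSOneShift

end Summit.NavierStokesRegularity.NavierStokesRegularity.Theorems
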